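import Summits.ABC.StewartYu.ArchG3LinesAtomsB
import Summits.ABC.StewartYu.ArchG3RecLinesClosedK
import HarnessLib

/-!
# Cell abc-stewartyu, rung A1.L (crux r2 `ArchCoreRat`, stmt-ABC-20502), WP-L.A: the θ-SIDE ATOMS with a GENERIC adjugate letter
# `|C| ≤ κ·N` (plan R49; κ := 2^{n−1} by `ArchG3LinesPathBound`), against the closed forms of `ArchG3RecLinesClosedK`

`Summits/ABC/StewartYu/ArchG3LinesAtomsC.lean` — cell `abc-stewartyu` (HOME `run/shared/lean/pub/abc-stewartyu/`; seat p5 g9).  Theorems only: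
the statements of `ArchG3LinesAtoms`/`ArchG3LinesAtomsB` that depend on the adjugate letter, re-proved VERBATIM with `(n−1)!` replaced by
a parameter `κ : ℕ` (`hCb : |Cⱼₖ| ≤ κ·N`): `sθR_leK`, `abs_b_leK`, `Lb_le_LbRK`, **`gammaC_sum_le_yRK`**, **`YC_le_YRK`**,
**`ceil_le_exp_cPRK`**, `yR_div_CR_leK`, `two_mul_le_exp_cbRK`.  With `κ := 2^{n−1}` (`SatData.abs_C_le_two_pow`) these are n-UNIFORM.

WHAT THIS IS NOT: no record inequality (seat p1, `ArchG3Rec.linesClosedK_holds`); no crux moves.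

## References
* Yu. V. Nesterenko, LNM 1819 (2003) — §3.5 (3.25), (3.36)–(3.37), Lemma 3.11, Prop. 3.9; §4.2 (4.22). [Nesterenko2003]
-/

noncomputable section

open Finset Matrix
open scoped Nat Matrix
open Literature.NumberTheory.Transcendental.CW77 (heightProd)
open Summit.ABC.StewartYu.ArchSupply (WC)

namespace Summit.ABC.StewartYu

namespace ArchG3Setup

namespace SatData

variable {S : ArchG3Setup} (F : S.SatData)

/-- **`sθR k ≤ (n−1)!·Σ_{j>k}(2Bv j+1) + (2Bv k+1) + 2`** (`C` lower-triangular, `|Cⱼₖ| ≤ (n−1)!N`, `Cₖₖ ≤ N`).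
[cite: Nesterenko2003, §3.5 (3.25); shape only] -/
theorem sθR_leK (κ : ℕ) (htri : ∀ k j : Fin S.n, k < j → F.U k j = 0) (hbox : ∀ k j : Fin S.n, 0 ≤ F.U k j ∧ F.U k j ≤ (F.N : ℤ))
    (hCb : ∀ j k : Fin S.n, |F.C j k| ≤ (κ : ℤ) * F.N) (P : ArchG3Rec S.n) (k : Fin S.n) :
    S.sθR F P k ≤ κ * ∑ j ∈ Ioi k, (2 * P.Bv j + 1) + (2 * P.Bv k + 1) + 2 := by
  classical
  obtain ⟨hCtri, -, hCpos⟩ := F.shape htri hbox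
  have hCkk := F.C_diag_le htri hbox k
  unfold sθR
  simp only [S.LνR_zero]
  refine Nat.add_le_add_right ?_ 2
  refine Nat.div_le_of_le_mul ?_
  -- termwise: j < k ↦ 0, j = k ↦ (2Bv k+1)·N, j > k ↦ (2Bv j+1)·(n−1)!·N
  have hterm : ∀ j, (2 * P.Bv j + 1) * (F.C j k).natAbs ≤
      (if k < j then κ * (2 * P.Bv j + 1) * F.N else 0) + (if j = k then (2 * P.Bv k + 1) * F.N else 0) := by
    intro j
    rcases lt_trichotomy j k with hjk | hjk | hjk
    · rw [hCtri j k hjk]; simp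
    · subst hjk
      rw [if_neg (lt_irrefl _), if_pos rfl, zero_add]
      refine Nat.mul_le_mul_left _ ?_
      have : ((F.C j j).natAbs : ℤ) ≤ F.N := by rw [Int.natAbs_of_nonneg (hCpos j).le]; exact hCkk
      exact_mod_cast this
    · rw [if_pos hjk, if_neg (ne_of_gt hjk), add_zero]
      have h1 : ((F.C j k).natAbs : ℤ) ≤ (κ : ℤ) * F.N := by rw [Int.natCast_natAbs]; exact hCb j k
      have h2 : (F.C j k).natAbs ≤ κ * F.N := by exact_mod_cast h1
      calc (2 * P.Bv j + 1) * (F.C j k).natAbs ≤ (2 * P.Bv j + 1) * (κ * F.N) := Nat.mul_le_mul_left _ h2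
        _ = κ * (2 * P.Bv j + 1) * F.N := by ring
  calc ∑ j, (2 * P.Bv j + 1) * (F.C j k).natAbs
      ≤ ∑ j, ((if k < j then κ * (2 * P.Bv j + 1) * F.N else 0) + (if j = k then (2 * P.Bv k + 1) * F.N else 0)) :=
        Finset.sum_le_sum fun j _ => hterm j
    _ = F.N * (κ * ∑ j ∈ Ioi k, (2 * P.Bv j + 1) + (2 * P.Bv k + 1)) := by
        rw [Finset.sum_add_distrib, Finset.sum_ite, Finset.sum_ite, Finset.sum_const_zero, Finset.sum_const_zero, add_zero, add_zero,
          Finset.filter_lt_eq_Ioi, Finset.filter_eq']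
        simp only [Finset.mem_univ, if_true, Finset.sum_singleton]
        rw [mul_add, Finset.mul_sum, Finset.mul_sum]
        congr 1
        · exact Finset.sum_congr rfl fun j _ => by ring
        · ring

/-- **`|b̃ₖ| ≤ (n−1)!·N·B·A_{j₀}·Σ_{j>k} 1/Aⱼ + N·B·A_{j₀}/Aₖ`** from `|bⱼ|·Aⱼ ≤ B·A_{j₀}`, `|Cⱼₖ| ≤ (n−1)!N` (`j > k`), `Cₖₖ ≤ N`. [folklore] -/
theorem abs_b_leK (κ : ℕ) (htri : ∀ k j : Fin S.n, k < j → F.U k j = 0) (hbox : ∀ k j : Fin S.n, 0 ≤ F.U k j ∧ F.U k j ≤ (F.N : ℤ))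
    (hCb : ∀ j k : Fin S.n, |F.C j k| ≤ (κ : ℤ) * F.N) {A : Fin S.n → ℝ} (hA0 : ∀ j, 0 < A j) {B : ℝ}
    (hbB : ∀ j, |(F.bo j : ℝ)| * A j ≤ B * A S.j₀) (k : Fin S.n) :
    |(S.b k : ℝ)| ≤ (κ : ℝ) * F.N * B * A S.j₀ * ∑ j ∈ Ioi k, 1 / A j + F.N * B * A S.j₀ / A k := by
  classical
  obtain ⟨-, -, hCpos⟩ := F.shape htri hbox
  have hCkk := F.C_diag_le htri hbox k
  have hbo : ∀ j, |(F.bo j : ℝ)| ≤ B * A S.j₀ / A j := fun j => by rw [le_div_iff₀ (hA0 j)]; exact hbB j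
  rw [F.b_eq_sum_Ici htri hbox k, ← Finset.Ioi_insert, Finset.sum_insert (by simp)]
  push_cast
  refine (abs_add_le _ _).trans ?_
  rw [add_comm]
  refine add_le_add ?_ ?_
  · refine (abs_sum_le_sum_abs _ _).trans ?_
    rw [Finset.mul_sum]
    refine Finset.sum_le_sum fun j hj => ?_
    rw [Finset.mem_Ioi] at hj
    rw [abs_mul]
    have hC : |(F.C j k : ℝ)| ≤ (κ : ℝ) * F.N := by exact_mod_cast hCb j k
    calc |(F.bo j : ℝ)| * |(F.C j k : ℝ)| ≤ (B * A S.j₀ / A j) * ((κ : ℝ) * F.N) :=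
          mul_le_mul (hbo j) hC (abs_nonneg _) (by have := hbo j; exact (abs_nonneg _).trans this)
      _ = (κ : ℝ) * F.N * B * A S.j₀ * (1 / A j) := by ring
  · rw [abs_mul]
    have hC : |(F.C k k : ℝ)| ≤ F.N := by
      rw [abs_of_pos (by exact_mod_cast hCpos k)]; exact_mod_cast hCkk
    calc |(F.bo k : ℝ)| * |(F.C k k : ℝ)| ≤ (B * A S.j₀ / A k) * F.N :=
          mul_le_mul (hbo k) hC (abs_nonneg _) ((abs_nonneg _).trans (hbo k))
      _ = F.N * B * A S.j₀ / A k := by ring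

/-- `Lb (sθR) lev k ≤ LbR lev k`. [folklore] -/
theorem Lb_le_LbRK (κ : ℕ) (htri : ∀ k j : Fin S.n, k < j → F.U k j = 0) (hbox : ∀ k j : Fin S.n, 0 ≤ F.U k j ∧ F.U k j ≤ (F.N : ℤ))
    (hCb : ∀ j k : Fin S.n, |F.C j k| ≤ (κ : ℤ) * F.N) (P : ArchG3Rec S.n) (lev : ℕ) (k : Fin S.n) :
    S.Lb (S.sθR F P) lev k ≤ P.LbRK κ lev k := by
  unfold ArchG3Rec.LbRK ArchG3Rec.sRRK
  exact S.Lb_le_of_le (fun j => F.sθR_leK κ htri hbox hCb P j) lev k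

/-- **The jets scalar: `Σₖ AθR k · GammaC (Lb lev) k ≤ yR lev`.** [cite: Nesterenko2003, §4.2 (4.22), Lemma 4.3; shape only] -/
theorem gammaC_sum_le_yRK (κ : ℕ) (htri : ∀ k j : Fin S.n, k < j → F.U k j = 0) (hbox : ∀ k j : Fin S.n, 0 ≤ F.U k j ∧ F.U k j ≤ (F.N : ℤ))
    (hCb : ∀ j k : Fin S.n, |F.C j k| ≤ (κ : ℤ) * F.N) (hlast : ∀ j, j ≤ S.j₀) (P : ArchG3Rec S.n) (hPN : P.N = F.N)
    (hbB : ∀ j, |(F.bo j : ℝ)| * P.A j ≤ P.Bexp * P.A S.j₀) (hbo1 : 1 ≤ |F.bo S.j₀|) (lev : ℕ) :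
    ∑ k, P.AθR k * S.GammaC (S.Lb (S.sθR F P) lev) k ≤ P.yRK κ lev := by
  classical
  obtain ⟨hCtri, hUCd, hCpos⟩ := F.shape htri hbox
  have hjl : P.jl = S.j₀ := jl_eq P hlast
  have hN : (0 : ℝ) < F.N := F.N_pos'
  have hA0 : ∀ j, 0 < P.A j := fun j => (P.A_facts j).1
  have hAθ0 : ∀ k, 0 ≤ P.AθR k := fun k => Finset.sum_nonneg fun j _ => (hA0 j).le
  unfold ArchG3Rec.yRK
  refine Finset.sum_le_sum fun k _ => mul_le_mul_of_nonneg_left ?_ (hAθ0 k)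
  -- `GammaC (Lb lev) k ≤ ΓR lev k`
  unfold GammaC ArchG3Rec.ΓRK
  have hL : ((S.Lb (S.sθR F P) lev k : ℕ) : ℝ) ≤ (P.LbRK κ lev k : ℝ) := by exact_mod_cast F.Lb_le_LbRK κ htri hbox hCb P lev k
  have hbt : |(S.b k : ℝ)| ≤ P.btRK κ k := by
    have h := F.abs_b_leK κ htri hbox hCb hA0 hbB k
    unfold ArchG3Rec.btRK ArchG3Rec.Alast; rw [hjl, hPN]; linarith
  have hCll : (1 : ℝ) ≤ (F.C S.j₀ S.j₀ : ℝ) := by exact_mod_cast hCpos S.j₀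
  have hCllN : (F.C S.j₀ S.j₀ : ℝ) ≤ F.N := by exact_mod_cast F.C_diag_le htri hbox S.j₀
  have hbj : (F.C S.j₀ S.j₀ : ℝ) ≤ |(S.b S.j₀ : ℝ)| := by
    rw [F.b_last_eq htri hbox hlast]; push_cast; rw [abs_mul, abs_of_pos (a := (F.C S.j₀ S.j₀ : ℝ)) (by linarith)]
    have : (1 : ℝ) ≤ |(F.bo S.j₀ : ℝ)| := by exact_mod_cast hbo1
    nlinarith
  have hbjpos : 0 < |(S.b S.j₀ : ℝ)| := by linarith
  have hLj := F.Lb_last_le htri hbox hlast P lev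
  -- the ratio term
  have hratio : |(S.b k : ℝ) / (S.b S.j₀ : ℝ)| * (S.Lb (S.sθR F P) lev S.j₀ : ℝ) ≤
      2 * P.btRK κ k * ((2 * P.Bv P.jl + 1 : ℝ) / P.N + 2) := by
    rw [abs_div, hjl, hPN]
    have hbt0 : 0 ≤ P.btRK κ k := (abs_nonneg _).trans hbt
    calc |(S.b k : ℝ)| / |(S.b S.j₀ : ℝ)| * (S.Lb (S.sθR F P) lev S.j₀ : ℝ)
        ≤ (P.btRK κ k / (F.C S.j₀ S.j₀ : ℝ)) * (2 * ((2 * P.Bv S.j₀ + 1 : ℝ) * (F.C S.j₀ S.j₀) / F.N + 2)) := by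
          refine mul_le_mul ?_ hLj (by positivity) (by positivity)
          exact div_le_div₀ hbt0 hbt (by linarith) hbj
      _ = 2 * P.btRK κ k * ((2 * P.Bv S.j₀ + 1 : ℝ) / F.N + 2 / (F.C S.j₀ S.j₀ : ℝ)) := by
          field_simp
      _ ≤ 2 * P.btRK κ k * ((2 * P.Bv S.j₀ + 1 : ℝ) / F.N + 2) := by
          refine mul_le_mul_of_nonneg_left ?_ (by positivity)
          have : 2 / (F.C S.j₀ S.j₀ : ℝ) ≤ 2 := by rw [div_le_iff₀ (by linarith)]; nlinarith
          linarith
  linarith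

/-- **The Δ-weight ceiling: `YC 1 0 (Lb lev) ≤ YR lev`.** [cite: Nesterenko2003, §3.5 (3.36); shape only] -/
theorem YC_le_YRK (κ : ℕ) (htri : ∀ k j : Fin S.n, k < j → F.U k j = 0) (hbox : ∀ k j : Fin S.n, 0 ≤ F.U k j ∧ F.U k j ≤ (F.N : ℤ))
    (hCb : ∀ j k : Fin S.n, |F.C j k| ≤ (κ : ℤ) * F.N) (hlast : ∀ j, j ≤ S.j₀) (P : ArchG3Rec S.n) (hPN : P.N = F.N)
    (hbB : ∀ j, |(F.bo j : ℝ)| * P.A j ≤ P.Bexp * P.A S.j₀) (lev : ℕ) :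
    S.YC 1 0 (S.Lb (S.sθR F P) lev) ≤ P.YRK κ lev := by
  classical
  obtain ⟨hCtri, hUCd, hCpos⟩ := F.shape htri hbox
  have hjl : P.jl = S.j₀ := jl_eq P hlast
  have hN : (0 : ℝ) < F.N := F.N_pos'
  have hA0 : ∀ j, 0 < P.A j := fun j => (P.A_facts j).1
  have hCll0 : (0 : ℝ) < (F.C S.j₀ S.j₀ : ℝ) := by exact_mod_cast hCpos S.j₀
  have hCllN : (F.C S.j₀ S.j₀ : ℝ) ≤ F.N := by exact_mod_cast F.C_diag_le htri hbox S.j₀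
  have hBexp0 : 0 ≤ P.Bexp := (Real.exp_pos _).le
  -- `|b̃_{j₀}| ≤ B·N`
  have hbj : |(S.b S.j₀ : ℝ)| ≤ P.Bexp * F.N := by
    rw [F.b_last_eq htri hbox hlast]; push_cast; rw [abs_mul, abs_of_pos hCll0]
    have h1 : |(F.bo S.j₀ : ℝ)| ≤ P.Bexp := le_of_mul_le_mul_right (by linarith [hbB S.j₀]) (hA0 S.j₀)
    exact mul_le_mul h1 hCllN hCll0.le hBexp0
  have hLj := F.Lb_last_le htri hbox hlast P lev
  unfold YC ArchG3Rec.YRK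
  refine Finset.sum_le_sum fun k _ => ?_
  have hL : ((S.Lb (S.sθR F P) lev k : ℕ) : ℝ) ≤ (P.LbRK κ lev k : ℝ) := by exact_mod_cast F.Lb_le_LbRK κ htri hbox hCb P lev k
  have hbt : |(S.b k : ℝ)| ≤ P.btRK κ k := by
    have h := F.abs_b_leK κ htri hbox hCb hA0 hbB k
    unfold ArchG3Rec.btRK ArchG3Rec.Alast; rw [hjl, hPN]; linarith
  have hbt0 : 0 ≤ P.btRK κ k := (abs_nonneg _).trans hbt
  simp only [Int.cast_one, abs_one, one_mul, Pi.zero_apply, Int.cast_zero, abs_zero, add_zero]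
  rw [hjl, hPN]
  have h1 : |(S.b S.j₀ : ℝ)| * (S.Lb (S.sθR F P) lev k : ℝ) ≤ P.Bexp * F.N * (P.LbRK κ lev k : ℝ) :=
    mul_le_mul hbj hL (by positivity) (by positivity)
  have h2 : |(S.b k : ℝ)| * (S.Lb (S.sθR F P) lev S.j₀ : ℝ) ≤ 2 * P.btRK κ k * (2 * P.Bv S.j₀ + 3 : ℝ) := by
    calc |(S.b k : ℝ)| * (S.Lb (S.sθR F P) lev S.j₀ : ℝ) ≤ P.btRK κ k * (2 * ((2 * P.Bv S.j₀ + 1 : ℝ) * (F.C S.j₀ S.j₀) / F.N + 2)) :=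
          mul_le_mul hbt hLj (by positivity) hbt0
      _ ≤ P.btRK κ k * (2 * ((2 * P.Bv S.j₀ + 1 : ℝ) * 1 + 2)) := by
          refine mul_le_mul_of_nonneg_left (mul_le_mul_of_nonneg_left ?_ (by norm_num)) hbt0
          have : (F.C S.j₀ S.j₀ : ℝ) / F.N ≤ 1 := by rw [div_le_one hN]; exact hCllN
          have h0 : (0 : ℝ) ≤ 2 * P.Bv S.j₀ + 1 := by positivity
          have := mul_le_mul_of_nonneg_left this h0
          rw [mul_div_assoc]; linarith
      _ = 2 * P.btRK κ k * (2 * P.Bv S.j₀ + 3 : ℝ) := by ring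
  linarith

/-- **`⌈#unkA·AmaxR⌉ ≤ exp cPR`** (lp-1's `log_AmaxR_le` at `(c, e) = (1, 0)`, `V = A`, with `YC 1 0 (Lb 0) ≤ YR 0`).
[cite: Nesterenko2003, §3.5 (3.37), Prop. 3.9; shape only] -/
theorem ceil_le_exp_cPRK (κ : ℕ) (htri : ∀ k j : Fin S.n, k < j → F.U k j = 0) (hbox : ∀ k j : Fin S.n, 0 ≤ F.U k j ∧ F.U k j ≤ (F.N : ℤ))
    (hCb : ∀ j k : Fin S.n, |F.C j k| ≤ (κ : ℤ) * F.N) (hlast : ∀ j, j ≤ S.j₀) (P : ArchG3Rec S.n) (hPN : P.N = F.N)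
    (hbB : ∀ j, |(F.bo j : ℝ)| * P.A j ≤ P.Bexp * P.A S.j₀) (hV : ∀ j, Height.logHeight₁ (F.αo j) ≤ P.A j)
    {U : Finset (ℕ × (Fin S.n → ℤ))} (hcount : U.card ≤ (P.L₀ + 1) * ∏ j, (S.LνR P 0 j + 1)) (hU1 : 1 ≤ U.card) :
    ((⌈(U.card : ℝ) * S.AmaxR F P 1 0⌉ : ℤ) : ℝ) ≤ Real.exp (P.cPRK κ) := by
  have hA1 : 1 ≤ S.AmaxR F P 1 0 := le_max_left _ _
  have hU1' : (1 : ℝ) ≤ U.card := by exact_mod_cast hU1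
  have hx1 : 1 ≤ (U.card : ℝ) * S.AmaxR F P 1 0 := one_le_mul_of_one_le_of_one_le hU1' hA1
  have hx0 : 0 < (U.card : ℝ) * S.AmaxR F P 1 0 := by linarith
  have hceil : ((⌈(U.card : ℝ) * S.AmaxR F P 1 0⌉ : ℤ) : ℝ) ≤ 2 * ((U.card : ℝ) * S.AmaxR F P 1 0) := by
    have := Int.ceil_lt_add_one ((U.card : ℝ) * S.AmaxR F P 1 0); linarith
  refine hceil.trans ?_
  unfold ArchG3Rec.cPRK
  rw [Real.exp_add, Real.exp_add, Real.exp_log (by norm_num), mul_assoc]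
  refine mul_le_mul_of_nonneg_left (mul_le_mul (card_le_exp_cUR P hcount) ?_ (by linarith) (Real.exp_pos _).le) (by norm_num)
  -- `AmaxR ≤ exp logAmaxRR`
  rw [← Real.exp_log (by linarith : 0 < S.AmaxR F P 1 0)]
  refine Real.exp_le_exp.mpr ((S.log_AmaxR_le F P 1 0 hV).trans ?_)
  unfold ArchG3Rec.logAmaxRRK
  have hYC : S.YC 1 0 (fun j => 2 * S.sθR F P j) ≤ P.YRK κ 0 := by
    have h := F.YC_le_YRK κ htri hbox hCb hlast P hPN hbB 0
    have he : (fun j => 2 * S.sθR F P j) = S.Lb (S.sθR F P) 0 := by funext j; rfl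
    rw [he]; exact h
  have hdir := dir_mono (P.Tf 0 0) (S.YC_nonneg 1 0 _) hYC
  have hsum : ∑ j, ((S.LνR P 0 j : ℝ) / F.N) * P.A j = ∑ j, ((P.LνRR 0 j : ℝ) / P.N) * P.A j := by
    refine Finset.sum_congr rfl fun j _ => ?_; rw [LνR_eq_LνRR, hPN]
  rw [hsum] at *
  linarith [hdir]

/-- `yR/CR ≤ T lev` (`CR = max 1 (yR/T)`). [folklore] -/
theorem yR_div_CR_leK (κ : ℕ) (P : ArchG3Rec S.n) (lev : ℕ) : P.yRK κ lev / P.CRK κ lev ≤ P.T lev := by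
  have hT : (1 : ℝ) ≤ P.T lev := by exact_mod_cast (P.T_facts lev).1
  unfold ArchG3Rec.CRK
  rcases le_or_gt (P.yRK κ lev / P.T lev) 1 with h | h
  · rw [max_eq_left h, div_one]; rwa [div_le_iff₀ (by linarith), one_mul] at h
  · rw [max_eq_right h.le]
    have hT0 : (0 : ℝ) < P.T lev := by linarith
    have hy0 : 0 < P.yRK κ lev := by have := (one_lt_div hT0).mp h; linarith
    rw [show P.yRK κ lev / (P.yRK κ lev / P.T lev) = P.T lev by field_simp]

/-- `2·(L·δ₀·m) ≤ exp (cbR c lev m)` when `L ≤ LbR lev jl`. [folklore] -/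
theorem two_mul_le_exp_cbRK (κ : ℕ) (P : ArchG3Rec S.n) (c : ℝ) (lev m : ℕ) {L : ℝ} (hL : L ≤ P.LbRK κ lev P.jl) :
    2 * (L * P.δR c * m) ≤ Real.exp (P.cbRK κ c lev m) := by
  unfold ArchG3Rec.cbRK ArchG3Rec.δR
  rw [Real.exp_sub, Real.exp_add, Real.exp_add, Real.exp_log (by norm_num), Real.exp_log (by positivity), Real.exp_log (by positivity),
    div_eq_mul_inv, ← Real.exp_neg]
  have h1 : L ≤ (P.LbRK κ lev P.jl : ℝ) + 1 := by linarith
  have h2 : (m : ℝ) ≤ m + 1 := by linarith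
  have h3 : 0 ≤ Real.exp (-P.U0 c) := (Real.exp_pos _).le
  calc 2 * (L * Real.exp (-P.U0 c) * m) = 2 * L * m * Real.exp (-P.U0 c) := by ring
    _ ≤ 2 * ((P.LbRK κ lev P.jl : ℝ) + 1) * (m + 1) * Real.exp (-P.U0 c) := by gcongr
    _ = 2 * ((P.LbRK κ lev P.jl : ℝ) + 1) * ((m : ℝ) + 1) * Real.exp (-P.U0 c) := by ring

end SatData

end ArchG3Setup

end Summit.ABC.StewartYu

end
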